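import Literature.AlgebraicGeometry.AbelianSchemes.RigidDescentAlongUnitSection
import Literature.AlgebraicGeometry.AbelianSchemes.RigidifiedIsoNormalize
import HarnessLib

/-!
# Rigid descent of a linearisation along the unit section of `A_T → T`, ANY test scheme `T` over a locally Noetherian base

Layer `Literature/AlgebraicGeometry/AbelianSchemes`, namespace `Literature.AlgebraicGeometry.AbelianSchemes.AbelianSchemeOver`.
THEOREMS ONLY (no definition, no named fact, no instance, no notation, no `sorry`; net Literature debt 0).

★ `AbelianSchemes/RigidDescentAlongUnitSection` proves Mumford's RIGID DESCENT of a `G`-linearisation along the unit section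
([MumfordAV1970] §8 pp. 78–80, the normalisation of the `K(L)`-linearisation of `Λ(L)` along `{0} × X`, made relative) for an
abelian scheme `p : A → T` over a REDUCED locally Noetherian `T`: the only place where reducedness is used is §1 there
(«a morphism `σ_g^* E → E` of line bundles is determined by its restriction along `ε`»), through ★
`RigidifiedAutOfReducedBase.hom_eq_of_pullback_unitSection_map_eq`, i.e. through the Stein property `Γ(A, 𝒪) = Γ(T, 𝒪)` of
★ `AbelianSchemeSteinOfReduced`.  THIS FILE removes the hypothesis on the test scheme for BASE-CHANGED abelian schemes: for
`A → S` over a LOCALLY NOETHERIAN `S` and ANY `f : T ⟶ S`, the abelian scheme `A_T := A.baseChange f → T` is Stein (★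
`AbelianSchemeSteinOfNoetherian`), so rigidified morphisms of line bundles on `A_T` are unique (★
`RigidifiedIsoNormalize.hom_baseChange_eq_of_pullback_unitSection_map_eq`, `T` arbitrary — in particular NON-reduced), and the
three statements of ★ `RigidDescentAlongUnitSection` §1/§3 hold for `A_T` VERBATIM with `[IsReduced T] [IsLocallyNoetherian T]`
replaced by `[IsLocallyNoetherian S]` (§2 there — rescaling, `exists_iso_restrictAlong_eq` — carries no hypothesis on the base and
is reused by name).

Setting: `A_T := A.baseChange f`; actions `ρ : ActionOver r G` on the total space `A_T.X.left` (over any `r`) and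
`τ : ActionOver r′ G` on `T`, the unit section `ε_T := A_T.unitSection` EQUIVARIANT (`hι : τ_g ≫ ε_T = ε_T ≫ σ_g`), a line bundle
`E` on `A_T` (`HasRank E 1`); ★ `Modules/EquivariantStructure(Restrict)` currency (`EquivariantStructure`, `restrictAlong`).

* §1 `hom_eq_of_restrictAlong_unitSection_eq_baseChange` — a morphism `σ_g^* E → E` is determined by its restriction along `ε_T`;
  `equivariantStructure_iso_eq_of_restrictAlong_eq_baseChange` — hence a `G`-linearisation of `E` is determined along `ε_T`.
* §2 **`exists_equivariantStructure_of_restrictAlong_unitSection_baseChange`** — RIGID DESCENT over ANY `T`: if `σ_g^* E ≅ E`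
  for every `g`, every `G`-linearisation `Ψ` of `ε_T^* E` for `τ` is the restriction along `ε_T` of a `G`-linearisation `Φ` of `E`
  for `ρ`; `existsUnique_equivariantStructure_iso_of_restrictAlong_unitSection_baseChange` — and `Φ` is unique.

Cell `hodgecm-mathlib` (D-0151), FLOOR 0 programme P1, sub-line `Cruxes/HDel/Lines/F3DualAbelianScheme` (author of record
B-plan1 (g19)), stub (M) `stub_F3M`, inner step (M-d): the Galois base-quotient descent of the étale-local dual pair needs ★
`DualPairBaseQuotientDescent.exists_dualPair_fields_of_free_base_quotient` WITHOUT its `[IsReduced D.hat.X.left]` hypothesis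
(over a non-reduced Noetherian `ℚ`-base the dual `Â` is not reduced); that hypothesis enters the chain exactly at ★
`PoincareBaseQuotientDescent` §2, which applies ★ `RigidDescentAlongUnitSection` §3 to the abelian scheme `A ×_S Â → Â` =
`A.baseChange D.hat.X.hom` — a BASE CHANGE, so §2 of this file is the drop-in (sequel: ★-to-be
`PoincareBaseQuotientDescentOfNoetherian`, `DualPairBaseQuotientDescentOfNoetherian`).  Count-neutral; HC_CM is proved only
modulo the 7 printed citations until rung 0 closes; nothing here is about HC.

Mathlib searched (pin): `cancel_epi`, `Iso.ext`, `Functor.mapIso_hom`; Mathlib has no abelian schemes, no linearisations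
and no Stein property of proper morphisms.

## References
* [MumfordAV1970] D. Mumford, *Abelian Varieties* (1970), §5 Cor. 6 (p. 54), §8 pp. 78–80 (normalisation along `{0} × X`),
  §13 (Thm. p. 125 and its proof: normalised isomorphisms of rigidified bundles are unique).
* [MumfordFogartyKirwan1994] D. Mumford, J. Fogarty, F. Kirwan, *GIT* 3rd ed. (1994), Ch. 1 §3 Def. 1.6 (p. 30)
  (`G`-linearisations); Ch. 6 §2 (p. 121).
* [MilneAV2008] J. S. Milne, *Abelian Varieties* (v2.00, 2008), I §8 pp. 36–37 and p. 40.
* [GortzWedhorn2023] U. Görtz, T. Wedhorn, *Algebraic Geometry II* (2023), Cor. 24.63 (p. 404) (cohomological flatness in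
  dimension `0`).
-/

set_option autoImplicit false

noncomputable section

universe u

open CategoryTheory CategoryTheory.Limits AlgebraicGeometry
open Literature.AlgebraicGeometry.RelativeSpec Literature.AlgebraicGeometry.Modules Literature.AlgebraicGeometry.Motives

namespace Literature.AlgebraicGeometry.AbelianSchemes

namespace AbelianSchemeOver

variable {S : Scheme.{u}} [IsLocallyNoetherian S] (A : AbelianSchemeOver S) {T : Scheme.{u}} (f : T ⟶ S)
  {Y Y' : Scheme.{u}} {r : (A.baseChange f).X.left ⟶ Y} {r' : T ⟶ Y'} {G : Type*} [Group G]
  (ρ : ActionOver r G) (τ : ActionOver r' G)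
  (hι : ∀ g : G, τ.autHom g ≫ (A.baseChange f).unitSection = (A.baseChange f).unitSection ≫ ρ.autHom g)
  {E : (A.baseChange f).X.left.Modules}

/-! ## §1 Morphisms `σ_g^* E → E` and linearisations on `A_T` are determined along the unit section (ANY `T`) -/

/-- **A would-be structure morphism `σ_g^* E → E` of a line bundle on `A_T = A ×_S T` is determined by its restriction along
the (equivariant) unit section `ε_T`**, for EVERY test scheme `T` over a locally Noetherian `S` (the comparison morphism an
isomorphism): `restrictAlong` is `squareIso ≫ ε_T^*(-)`, and rigidified morphisms of line bundles on `A_T` are unique (★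
`hom_baseChange_eq_of_pullback_unitSection_map_eq`, Stein property of `A_T → T`).  ★
`hom_eq_of_restrictAlong_unitSection_eq` with `[IsReduced T] [IsLocallyNoetherian T]` replaced by `[IsLocallyNoetherian S]`.
[cite: MumfordAV1970, §8 (pp. 78–80) and §13 (p. 125)] [cite: MumfordFogartyKirwan1994, Ch. 1 §3 Definition 1.6 (p. 30)] -/
theorem hom_eq_of_restrictAlong_unitSection_eq_baseChange (h₁ : HasRank E 1) (g : G)
    (ψ χ : (Scheme.Modules.pullback (ρ.autHom g)).obj E ⟶ E) [IsIso χ]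
    (h : restrictAlong ρ τ (A.baseChange f).unitSection hι E g ψ =
      restrictAlong ρ τ (A.baseChange f).unitSection hι E g χ) : ψ = χ := by
  refine A.hom_baseChange_eq_of_pullback_unitSection_map_eq f (hasRank_pullback _ h₁) ψ χ ?_
  rw [restrictAlong, restrictAlong] at h
  exact (cancel_epi (squareIso (hι g) E).hom).1 h

/-- **A `G`-linearisation of a line bundle on `A_T` is determined by its restriction along the unit section** (ANY `T` over a
locally Noetherian `S`). [cite: MumfordAV1970, §8 (pp. 78–80)] [cite: MumfordFogartyKirwan1994, Ch. 1 §3 Definition 1.6 (p. 30)] -/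
theorem equivariantStructure_iso_eq_of_restrictAlong_eq_baseChange (h₁ : HasRank E 1) (Φ Φ' : ρ.EquivariantStructure E)
    (h : ∀ g : G, restrictAlong ρ τ (A.baseChange f).unitSection hι E g (Φ.iso g).hom =
      restrictAlong ρ τ (A.baseChange f).unitSection hι E g (Φ'.iso g).hom) (g : G) : Φ.iso g = Φ'.iso g :=
  Iso.ext (A.hom_eq_of_restrictAlong_unitSection_eq_baseChange f ρ τ hι h₁ g _ _ (h g))

/-! ## §2 Rigid descent of a linearisation along the unit section of `A_T` (ANY `T`) -/

/-- **RIGID DESCENT OF A LINEARISATION ALONG THE UNIT SECTION, ANY TEST SCHEME.**  Let `A → S` be an abelian scheme over a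
locally Noetherian `S`, `f : T ⟶ S` ANY morphism (`T` possibly non-reduced), `A_T := A ×_S T → T` with unit section `ε_T`,
`ρ` an action of `G` on `A_T` and `τ` one on `T` making `ε_T` equivariant, and `E` a line bundle on `A_T` with `σ_g^* E ≅ E` for
every `g ∈ G`.  Then every `G`-linearisation `Ψ` of `ε_T^* E` (for `τ`) is the restriction along `ε_T` of a `G`-linearisation
`Φ` of `E` (for `ρ`) — unique by `equivariantStructure_iso_eq_of_restrictAlong_eq_baseChange`.  (Each `Φ_g`: ★
`exists_iso_restrictAlong_eq` — rescale by a unit read off on `T`, no hypothesis on the base; unit and cocycle conditions: both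
sides are isomorphisms `σ^* E ≅ E` with the same restriction along `ε_T` — ★ `restrictAlong_pullbackOneIso`, ★ `restrictAlong_mul`
— hence equal, §1.)  Mumford's normalisation of the `K(L)`-linearisation of `Λ(L)` along `{0} × X`, in families over an
arbitrary test scheme; ★ `exists_equivariantStructure_of_restrictAlong_unitSection` without `IsReduced`.
[cite: MumfordAV1970, §8 (pp. 78–80) and §13 (p. 125)] [cite: MumfordFogartyKirwan1994, Ch. 1 §3 Definition 1.6 (p. 30)]
[cite: MilneAV2008, I §8 p. 40] -/
theorem exists_equivariantStructure_of_restrictAlong_unitSection_baseChange (h₁ : HasRank E 1)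
    (hT : ∀ g : G, Nonempty ((Scheme.Modules.pullback (ρ.autHom g)).obj E ≅ E))
    (Ψ : τ.EquivariantStructure ((Scheme.Modules.pullback (A.baseChange f).unitSection).obj E)) :
    ∃ Φ : ρ.EquivariantStructure E,
      ∀ g : G, restrictAlong ρ τ (A.baseChange f).unitSection hι E g (Φ.iso g).hom = (Ψ.iso g).hom := by
  have hE : IsFiniteLocallyFree E := HasRank.isFiniteLocallyFree' h₁
  have step : ∀ g : G, ∃ φ : (Scheme.Modules.pullback (ρ.autHom g)).obj E ≅ E,
      restrictAlong ρ τ (A.baseChange f).unitSection hι E g φ.hom = (Ψ.iso g).hom := fun g =>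
    (A.baseChange f).exists_iso_restrictAlong_eq ρ τ hι h₁ g (hT g).some (Ψ.iso g)
  choose φ hφ using step
  refine ⟨{ iso := φ, iso_one := ?_, iso_mul := fun g h => ?_ }, hφ⟩
  · -- unit condition
    refine Iso.ext (A.hom_eq_of_restrictAlong_unitSection_eq_baseChange f ρ τ hι h₁ 1 _ _ ?_)
    rw [hφ, Ψ.iso_one, restrictAlong_pullbackOneIso ρ τ (A.baseChange f).unitSection hι hE]
  · -- cocycle condition
    refine Iso.ext (A.hom_eq_of_restrictAlong_unitSection_eq_baseChange f ρ τ hι h₁ (g * h) _ _ ?_)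
    simp only [Iso.trans_hom, Functor.mapIso_hom]
    rw [hφ, Ψ.iso_mul, restrictAlong_mul ρ τ (A.baseChange f).unitSection hι hE, hφ, hφ]
    rfl

/-- The same with the UNIQUENESS clause packaged: over ANY test scheme `T` the lifted linearisation is unique.
[cite: MumfordAV1970, §8 (pp. 78–80) and §13 (p. 125)] [cite: MilneAV2008, I §8 pp. 36–37] -/
theorem existsUnique_equivariantStructure_iso_of_restrictAlong_unitSection_baseChange (h₁ : HasRank E 1)
    (hT : ∀ g : G, Nonempty ((Scheme.Modules.pullback (ρ.autHom g)).obj E ≅ E))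
    (Ψ : τ.EquivariantStructure ((Scheme.Modules.pullback (A.baseChange f).unitSection).obj E)) :
    ∃ Φ : ρ.EquivariantStructure E,
      (∀ g : G, restrictAlong ρ τ (A.baseChange f).unitSection hι E g (Φ.iso g).hom = (Ψ.iso g).hom) ∧
        ∀ Φ' : ρ.EquivariantStructure E,
          (∀ g : G, restrictAlong ρ τ (A.baseChange f).unitSection hι E g (Φ'.iso g).hom = (Ψ.iso g).hom) →
            ∀ g : G, Φ'.iso g = Φ.iso g := by
  obtain ⟨Φ, hΦ⟩ := A.exists_equivariantStructure_of_restrictAlong_unitSection_baseChange f ρ τ hι h₁ hT Ψ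
  exact ⟨Φ, hΦ, fun Φ' hΦ' g =>
    A.equivariantStructure_iso_eq_of_restrictAlong_eq_baseChange f ρ τ hι h₁ Φ' Φ (fun g => (hΦ' g).trans (hΦ g).symm) g⟩

end AbelianSchemeOver

end Literature.AlgebraicGeometry.AbelianSchemes

end
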